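import Summits.CriticalPhenomena.PercolationContinuityZ3.Theorems.Transplant.SiteSetRestrict
import HarnessLib

/-!
# SITE percolation restricted to `U`: the domain Markov property at the cluster of a source set
# (WP1/WP4/WP6 tool of the site CSH re-typing, P1-SITE-Z3 §12; site twin of `CovTau.sum_cond_sC`)

builds on p205010 (kernel theorem, internal audit signed; external expert review pending).

Bond (`CovTauA2Anti`): the event `{C^U_N = W}` is decided by the pairs MEETING `W`, and the pairs inside `U ∖ W` are fresh.  SITE: the event
`{setC Γ U N ω = W}` is decided by the STATES of the dead set `deadOf Γ N W = N ∪ W ∪ ∂W` (sources, cluster, vertex boundary), and the states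
of the site world `srest Γ U N ω = U ∖ deadOf` are fresh:
* `setC_eq_of_agree` / `setC_inter_dead_eq_iff` — locality of the value of the set cluster;
* `srest_eq_filter` — the world is `U` filtered by `∉ deadOf Γ N (C_N)`;
* **`sum_cond_setC`** — `Σ_ω weight(ω) Φ(C_N(ω), ω ∩ srest) = Σ_ω weight(ω) Σ_ω' weight(ω') Φ(C_N(ω), ω' ∩ srest)` for every `Φ`
  (conditioning on the value of `C_N`; `blockFubini` with the block `deadOf`).
Support file (`--supports stmt-CriticalPhenomena-4575 --as helper`); one definition (`deadOf`), no named facts, no sorries.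
[cite: VandenbergHaggstromKahn2005, §1 pp. 7–8, display (10); §2.1 Lemma 2.4 (p. 10)]
-/

noncomputable section

namespace Summit.CriticalPhenomena.PercolationContinuityZ3.Theorems.Transplant

namespace SiteBHK

open Literature.Probability.Percolation
open Literature.Probability.Percolation.BHK2006 (weight weight_nonneg blockFubini)
open scoped Classical

variable {V : Type*} (Γ : SimpleGraph V)

/-- **The dead set of a candidate cluster value `W` of the source set `N`**: the sources, the cluster and its vertex boundary
(the vertices whose states decide `{C_N = W}` and which are removed from the world). [cite: VandenbergHaggstromKahn2005, §1 pp. 7–8] -/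
def deadOf (N W : Set V) : Set V := {u | u ∈ N ∨ u ∈ W ∨ ∃ c ∈ W, Γ.Adj u c}

variable {Γ}

/-- Negated membership in the dead set. [folklore] -/
theorem not_mem_deadOf {N W : Set V} {u : V} : u ∉ deadOf Γ N W ↔ u ∉ N ∧ u ∉ W ∧ ∀ c ∈ W, ¬ Γ.Adj u c := by
  simp only [deadOf, Set.mem_setOf_eq, not_or, not_exists, not_and]

/-- The site world is `U` filtered by "not dead for the value of the cluster". [folklore] -/
theorem srest_eq_filter (U : Finset V) (N : Set V) (ω : Set V) :
    srest Γ U N ω = U.filter fun u => u ∉ deadOf Γ N (setC Γ U N ω) := by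
  ext u
  rw [mem_srest, Finset.mem_filter, not_mem_deadOf]

/-- An open path inside `U` starting in a set `W` closed under open `U`-adjacency stays in `W`. [folklore] -/
theorem reach_stays {U : Finset V} {ω : Set V} {W : Set V} {a b : V}
    (hW : ∀ p q : V, p ∈ W → (siteOpenGraph Γ (ω ∩ ↑U)).Adj p q → q ∈ W)
    (h : (siteOpenGraph Γ (ω ∩ ↑U)).Reachable a b) (ha : a ∈ W) : b ∈ W := by
  rw [SimpleGraph.reachable_iff_reflTransGen] at h
  induction h with
  | refl => exact ha
  | tail _ hbc ih => exact hW _ _ ih hbc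

/-- The set cluster is closed under open `U`-adjacency. [folklore] -/
theorem setC_closed {U : Finset V} {N : Set V} {ω : Set V} {p q : V} (hp : p ∈ setC Γ U N ω)
    (hpq : (siteOpenGraph Γ (ω ∩ ↑U)).Adj p q) : q ∈ setC Γ U N ω := by
  obtain ⟨z, hz, hzo, _, hr⟩ := hp
  obtain ⟨-, -, hq⟩ := adj_iff.1 hpq
  exact ⟨z, hz, hzo, ⟨hq.1, hq.2⟩, hr.trans hpq.reachable⟩

/-- **Locality of `{C_N = W}`** (site): if `C^U_N(ω) = W` and `ω'` agrees with `ω` on the dead set of `W`, then `C^U_N(ω') = W`.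
[cite: VandenbergHaggstromKahn2005, §1 pp. 7–8] -/
theorem setC_eq_of_agree {U : Finset V} {N : Set V} {ω ω' : Set V} {W : Set V} (hW : setC Γ U N ω = W)
    (hag : ∀ u ∈ deadOf Γ N W, (u ∈ ω ↔ u ∈ ω')) : setC Γ U N ω' = W := by
  -- `W` is closed under open `U`-adjacency of `ω'`
  have hcl' : ∀ p q : V, p ∈ W → (siteOpenGraph Γ (ω' ∩ ↑U)).Adj p q → q ∈ W := by
    intro p q hp hpq
    obtain ⟨hadj, ⟨_, hpU⟩, ⟨hqo', hqU⟩⟩ := adj_iff.1 hpq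
    have hqd : q ∈ deadOf Γ N W := Or.inr (Or.inr ⟨p, hp, hadj.symm⟩)
    have hqo : q ∈ ω := (hag q hqd).2 hqo'
    have hpW : p ∈ setC Γ U N ω := hW ▸ hp
    have hpo : p ∈ ω := (setC_subset U N ω hpW).1
    rw [← hW]
    exact setC_closed hpW (adj_iff.2 ⟨hadj, ⟨hpo, hpU⟩, ⟨hqo, hqU⟩⟩)
  ext u
  constructor
  · rintro ⟨z, hz, hzo', huo', hr⟩
    -- the source `z` is open in `ω'`, hence in `ω`, hence `z ∈ W`; then the `ω'`-path stays in `W`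
    have hzd : z ∈ deadOf Γ N W := Or.inl hz
    have hzo : z ∈ ω := (hag z hzd).2 hzo'.1
    have hzW : z ∈ W := by
      rw [← hW]; exact ⟨z, hz, ⟨hzo, hzo'.2⟩, ⟨hzo, hzo'.2⟩, SimpleGraph.Reachable.refl z⟩
    exact reach_stays hcl' hr hzW
  · intro hu
    have hu' : u ∈ setC Γ U N ω := hW ▸ hu
    obtain ⟨z, hz, hzo, huo, hr⟩ := hu'
    -- the `ω`-path from `z` stays in `W = C_N(ω)`, so its vertices are dead, hence open in `ω'`
    have hclω : ∀ p q : V, p ∈ W → (siteOpenGraph Γ (ω ∩ ↑U)).Adj p q → q ∈ W := by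
      intro p q hp hpq; rw [← hW] at hp ⊢; exact setC_closed hp hpq
    have hzW : z ∈ W := by rw [← hW]; exact ⟨z, hz, hzo, hzo, SimpleGraph.Reachable.refl z⟩
    have hop : ∀ p ∈ W, p ∈ ω → p ∈ ω' := fun p hp hpo => (hag p (Or.inr (Or.inl hp))).1 hpo
    refine ⟨z, hz, ⟨hop z hzW hzo.1, hzo.2⟩, ⟨hop u hu huo.1, huo.2⟩, ?_⟩
    rw [SimpleGraph.reachable_iff_reflTransGen] at hr ⊢
    induction hr with
    | refl => exact Relation.ReflTransGen.refl
    | @tail b c hab hbc ih =>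
      have hbW : b ∈ W := reach_stays hclω ((SimpleGraph.reachable_iff_reflTransGen _ _).2 hab) hzW
      have hcW : c ∈ W := hclω b c hbW hbc
      obtain ⟨hadj, ⟨hbo, hbU⟩, ⟨hco, hcU⟩⟩ := adj_iff.1 hbc
      exact (ih (hW ▸ hbW) ⟨hbo, hbU⟩).tail (adj_iff.2 ⟨hadj, ⟨hop b hbW hbo, hbU⟩, ⟨hop c hcW hco, hcU⟩⟩)

/-- `{C_N = W}` is decided by the states of the dead set of `W`. [folklore] -/
theorem setC_inter_dead_eq_iff (U : Finset V) (N : Set V) (ω : Set V) (W : Set V) :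
    setC Γ U N (ω ∩ deadOf Γ N W) = W ↔ setC Γ U N ω = W :=
  ⟨fun h => setC_eq_of_agree h fun _ hu => ⟨fun h' => h'.1, fun h' => ⟨h', hu⟩⟩,
    fun h => setC_eq_of_agree h fun _ hu => ⟨fun h' => ⟨h', hu⟩, fun h' => h'.1⟩⟩

/-- The states off the dead set, read on the world, are the states on the world. [folklore] -/
theorem diff_dead_inter_filter (U : Finset V) (N W : Set V) (ω : Set V) :
    (ω \ deadOf Γ N W) ∩ (↑(U.filter fun u => u ∉ deadOf Γ N W) : Set V) =
      ω ∩ ↑(U.filter fun u => u ∉ deadOf Γ N W) := by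
  ext u
  simp only [Set.mem_inter_iff, Set.mem_sdiff, Finset.coe_filter, Set.mem_setOf_eq]
  tauto

variable [Fintype V]

/-- **Conditioning on the value of the set cluster** (site domain Markov property): for every `Φ`,
`Σ_ω weight(ω) Φ(C_N(ω), ω ∩ srest(ω)) = Σ_ω weight(ω) Σ_ω' weight(ω') Φ(C_N(ω), ω' ∩ srest(ω))` — given `C_N`, the states of the site
world are fresh. [cite: VandenbergHaggstromKahn2005, §1 pp. 7–8, display (10); §2.1 Lemma 2.4 (p. 10)] -/
theorem sum_cond_setC (q : V → ℝ) (hm : ∑ ω, weight q ω = 1) (U : Finset V) (N : Set V)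
    (Φ : Set V → Set V → ℝ) :
    ∑ ω, weight q ω * Φ (setC Γ U N ω) (ω ∩ ↑(srest Γ U N ω)) =
      ∑ ω, weight q ω * ∑ ω', weight q ω' * Φ (setC Γ U N ω) (ω' ∩ ↑(srest Γ U N ω)) := by
  -- fibrewise over the value `W` of the cluster
  have key : ∀ W : Set V,
      ∑ ω, (if setC Γ U N ω = W then
        weight q ω * Φ W (ω ∩ ↑(U.filter fun u => u ∉ deadOf Γ N W)) else 0) =
      ∑ ω, (if setC Γ U N ω = W then
        weight q ω * ∑ ω', weight q ω' * Φ W (ω' ∩ ↑(U.filter fun u => u ∉ deadOf Γ N W)) else 0) := by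
    intro W
    set Ψ : Set V → Set V → ℝ := fun ζ η =>
      if setC Γ U N ζ = W then Φ W (η ∩ ↑(U.filter fun u => u ∉ deadOf Γ N W)) else 0 with hΨ
    have h1 : ∀ ω, (if setC Γ U N ω = W then
        weight q ω * Φ W (ω ∩ ↑(U.filter fun u => u ∉ deadOf Γ N W)) else 0) =
        weight q ω * Ψ (ω ∩ deadOf Γ N W) (ω \ deadOf Γ N W) := by
      intro ω
      simp only [hΨ, setC_inter_dead_eq_iff, diff_dead_inter_filter]
      split_ifs <;> simp
    have h2 : ∀ ω ω', Ψ (ω ∩ deadOf Γ N W) (ω' \ deadOf Γ N W) =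
        if setC Γ U N ω = W then Φ W (ω' ∩ ↑(U.filter fun u => u ∉ deadOf Γ N W)) else 0 := by
      intro ω ω'
      simp only [hΨ, setC_inter_dead_eq_iff, diff_dead_inter_filter]
    calc ∑ ω, (if setC Γ U N ω = W then
          weight q ω * Φ W (ω ∩ ↑(U.filter fun u => u ∉ deadOf Γ N W)) else 0)
        = (∑ ω, weight q ω) * ∑ ω, weight q ω * Ψ (ω ∩ deadOf Γ N W) (ω \ deadOf Γ N W) := by
          rw [hm, one_mul]; simp_rw [h1]
      _ = ∑ ω, weight q ω * ∑ ω', weight q ω' * Ψ (ω ∩ deadOf Γ N W) (ω' \ deadOf Γ N W) :=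
          blockFubini q (deadOf Γ N W) Ψ
      _ = _ := by
          refine Finset.sum_congr rfl fun ω _ => ?_
          by_cases hc : setC Γ U N ω = W <;> simp [h2, hc]
  -- assemble the fibres
  have lhs : ∑ ω, weight q ω * Φ (setC Γ U N ω) (ω ∩ ↑(srest Γ U N ω)) =
      ∑ ω, ∑ W : Set V, (if setC Γ U N ω = W then
        weight q ω * Φ W (ω ∩ ↑(U.filter fun u => u ∉ deadOf Γ N W)) else 0) := by
    refine Finset.sum_congr rfl fun ω _ => ?_
    rw [Finset.sum_ite_eq Finset.univ (setC Γ U N ω)]; simp [srest_eq_filter]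
  have rhs : ∑ ω, weight q ω * ∑ ω', weight q ω' * Φ (setC Γ U N ω) (ω' ∩ ↑(srest Γ U N ω)) =
      ∑ ω, ∑ W : Set V, (if setC Γ U N ω = W then
        weight q ω * ∑ ω', weight q ω' * Φ W (ω' ∩ ↑(U.filter fun u => u ∉ deadOf Γ N W)) else 0) := by
    refine Finset.sum_congr rfl fun ω _ => ?_
    rw [Finset.sum_ite_eq Finset.univ (setC Γ U N ω)]; simp [srest_eq_filter]
  rw [lhs, rhs, Finset.sum_comm]
  conv_rhs => rw [Finset.sum_comm]
  exact Finset.sum_congr rfl fun W _ => key W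

end SiteBHK

end Summit.CriticalPhenomena.PercolationContinuityZ3.Theorems.Transplant
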